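import Literature.MathematicalPhysics.QuantumFieldTheory.Balaban1983to89.T4UniformDefectWiring
import Literature.MathematicalPhysics.QuantumFieldTheory.Balaban1983to89.T4SeparableFibreExpansion

/-!
# `Balaban1983to89.T4UniformDefectJunction` — the JUNCTION of observable-level telescoping with the cell's per-term channel:
# the lane's pulled-back loop product IS pv16's weight `loopProdW` (kernel one-liner), hence the per-term conditional-mean gap
# for it BY NAME from b07's averaging-side shapes + the law-side data; the two sides bundled; near/far; the separability
# channel's decay in closed form; (W1) re-typed one level finer (`UniformJunctionSupply`, `UniformSidesSupply`, and the
# mass-weighted `UniformWeightedJunction`) and closed to `T4UniformDefectWiring.UniformSupGap` / `UniformTermwiseGap` BY NAME;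
# end-to-end corollaries (cell T4, node O3b/H2 = NE1′ → U5; bookkeeping)

HONEST FRAMING.  Audit cell `pub-balaban`, unit `b2b-balaban-t4-ne1p-p3-g5` (T⁴-continuum fan-out, PROVER seat P3 for the
spine estimate NE1′ = DRESSED STABILITY in the observable-attached format, lineage generation 5; journal row
`T4-O3.E-NE1′-PROVE-P3e*`, companion record `HOME/t4/T4-EST-NE1p-P3.md` v5 §10).  ASSIGNED TECHNIQUE of the seat (unchanged):
«observable-level telescoping: write ⟨F⟩ differences as telescoping sums over scales and bound each increment by the printed
one-step contraction + the μ-derivative of the effective action».  Generations 1–4 (`T4ObservableTelescope`,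
`T4ObservableTelescopeTwoRun`, `T4UniformDefectWiring`) proved the identities, the summation lemmas, the existence theorems and
the (W1) wiring of the lane: `UniformGeomDefect D g₀` follows from ONE typed per-step datum, `UniformSupGap D g₀` — a
(0.3)-representation of each realised step and a UNIFORM conditional-mean gap `C·rⁿ` of every term for the loop product of
the run pulled back to the step's level (`loopPullback D Cs k n`).  Meanwhile the `pv16` lineage typed the cell's per-term
(CM) channel for products of loop variables of iterated averages, `T4SeparableFibreExpansion.condMeanGap_of_loopProd[Loc]`:
`CondMeanGap s ins old (loopProdW av j n ws) (…)` from b07's first- and second-difference shapes (`T4AvgDerivBound`) and the two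
laws' conditional-mean suppression data, and left the identification of its weight `loopProdW` with this lane's
`loopPullback` to the consumer (its header, item (v)).  THIS MODULE is that junction and the bookkeeping behind it, so that
(W1) is now typed ONE LEVEL FINER than `UniformSupGap`, in the currencies the cell's suppliers actually produce: b07's
averaging-side shapes with K-uniform constants, per-near-term law-side data, near/far, and the decay of two channels — of
which the separability channel's decay is PROVED here from the averaging side's rates (§4b) and only the law channel's is a
binder — in BOTH of the parent module's currencies: the uniform per-term gap (§4, `UniformSupGap`) and the mass-weighted budget
(§4c, `UniformTermwiseGap`), the latter being the one in which a term with a large fibre pays with its small mass.  The cell's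
T4 target is the existence and uniqueness of the continuum limit of unit-scale averaged loop
expectations on a FINITE torus with Bałaban's densities as GIVEN data and the printed end statement (B) and the β-hypothesis
as HYPOTHESES (the prefix `T4Continuum.FiniteEpsData.UnderHypotheses`); it is NOT an infinite-volume statement, NOT a mass
gap, NOT the Clay problem, and this module is NOT progress on any summit.  Every conditional of the cell (BetaPertH, (B),
(B^μ)) is ABSENT from §1–§4c (nothing there is about Bałaban's estimates) and is the explicit antecedent of `UnderHypotheses`
in the target corollaries of §5; none is hidden in a definition.

CITATION HEADER.  From T. Bałaban's series (CMP 1984–89) this module takes ONLY what the imported tree modules already quote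
and model, re-used BY NAME through `T4UniformDefectWiring` (the (0.3)/(0.4) shape of one large-field term and its printed
proviso, `TermRep` / `TermProvisos`; the realised steps `D.real.Trho`, `D.real.R` of `T4Continuum.FiniteEpsData`, abstract)
and through `T4SeparableFibreExpansion` / `T4AvgDerivBound` / `T4CondMeanChannelInsert` (the typed HYPOTHESIS SHAPES
`LoopDerivBound`, `LoopPairDerivBound`, `AvgStepContraction`, `CondMeanSuppression`, none of which is a printed statement —
their own headers say NOT PRINTED).  No page of the series was newly read for this module; no sentence is newly attributed to
it; nothing of Bałaban's averaging operations, small-field densities, minimisers or R beyond the cited tree shapes is encoded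
(cell DIVERGENCE F6/F9 honoured).  ABSOLUTE RULE honoured: no programme-internal statement is a hypothesis-free input — every
representation, every shape, every law-side datum, every cap and every decay enters as a binder (`AvgSide`, `LawSide[Loc]`,
`NearFarStep`, `JunctionStep`, `UniformJunctionSupply`, `UniformSidesSupply`, `WeightedJunctionStep`, `UniformWeightedJunction`
are DATA / HYPOTHESIS SHAPES, never asserted);
every declaration is [folklore] bookkeeping; the two print-located target tags of §5 are those of the parent module's
corresponding corollaries, unchanged.

WHAT IS PROVED (all [folklore]; no `sorry`, no new axiom):
§1 THE JUNCTION ONE-LINER IN THE KERNEL.  `pullback av k n f = f ∘ iterFrom av k n` (`pullback_eq_comp_iterFrom`,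
   `pullback_apply`: generation 3's cast-free pull-back, outermost averaging first, and `T4AvgSensitivity.iterFrom`, innermost
   first, are the same composite); the (base site, word) list of a string of loop labels at run `K` (`loopWords`, closed walks
   by `UWord.IsLoop.walkEnd_atLevel`: `loopWords_closed`); `prodLoop K Cs V = ∏ loopAt V (walk …)` over that list
   (`prodLoop_eq_prod_loopWords`); the level constraint `k+1+n ≤ m+K` of the b07 shapes is automatic for the run `K = k+1+n`
   (`levels_le`); and THE IDENTIFICATION `loopPullback D Cs k n = loopProdW (D.av (k+1+n)) (k+1) n (loopWords F (k+1+n) Cs)`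
   (`loopPullback_eq_loopProdW`).
§2 THE PER-TERM GAP FOR THE LANE'S WEIGHT, BY NAME.  pv16's `condMeanGap_of_loopProd` (fixed reference `(V₀, y₀)`) and
   `condMeanGap_of_loopProdLoc` (local reference) transported along §1: for one dressed term at level `k+1` of the
   `(k+1+n)`-th torus, `CondMeanGap s ins old (loopPullback D Cs k n) ((|s|·lip₁·d₁ + rate·Δ₁) + (|s|·lip₂·d₂ + rate·Δ₂))`,
   `rate = loopProdRate C₁ θ₁ C₂ θ₂ n (loopWords …)` (`condMeanGap_loopPullback`, `condMeanGap_loopPullback_loc`) — every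
   shape, datum, cover and window an explicit hypothesis, exactly pv16's.
§3 THE TWO SIDES BUNDLED.  `AvgSide av` — b07's shapes of one run (domains, `LoopDerivBound C₁ θ₁`, `LoopPairDerivBound C₂ θ₂`,
   `FibreConvex`, non-negative constants) with the pair rate `AvgSide.rate` (`= loopProdRate`, `rate_nonneg`) and THE INCREMENT
   BOUND BY THE ONE-STEP CONTRACTION: `AvgSide.ofStepContraction` builds the first-difference half with `(C₁, θ₁) = (Lip, θ)`
   from `ReTrLip`, `DomStable`, `GaugeStable` and ONE-STEP `AvgStepContraction θ` by b07's tower chain rule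
   `loopDerivBound_of_stepContraction` (the seat's technique, by name; the second-difference half stays a binder).
   `LawSide s ins old g domj` / `LawSideLoc …` — the law-side + cover/window binders of pv16's two theorems for one term,
   bundled field by field (the floored datum of pv16 v1.2 §5, `condMeanSuppression_incrReading_of_split` with deviation
   `lip·dev + κ` and modulus `1`, fits as typed); the two channels `lawChannel = |s|·lip₁·d₁ + |s|·lip₂·d₂` (first order, where
   «count of fibre bonds × size» enters: `lawChannel_le`) and `sepChannel rate = rate·Δ₁ + rate·Δ₂` (second order), `total_eq`;
   and `condMeanGap_of_sides[Loc]`: both sides supplied ⇒ `CondMeanGap … (loopPullback D Cs k n) (lawChannel + sepChannel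
   (rate n))`.
§4 NEAR/FAR AND DECAY, TO THE WALL'S NAME.  HYPOTHESIS SHAPES per `(Cs, k, n)`: `NearFarStep D g₀ Cs η k n` (a `TermRep` of the
   realised step, a predicate `near`, gap `η` on near terms, `FibreIndep` of the weight on far terms — the hypothesis-level
   near/far constructor the parent module's cross-read asked for), `JunctionStep D g₀ Cs a₁ a₂ k n` (near terms carry an
   `AvgSide` + a `LawSide`/`LawSideLoc` with channel budgets `a₁, a₂`); per string: `UniformNearFarGap` (`η = C·rⁿ`),
   `UniformTwoChannelGap` (`η = A₁r₁ⁿ + A₂r₂ⁿ`), `UniformJunctionSupply` (budgets `A₁r₁ⁿ, A₂r₂ⁿ`).  THEOREMS: far terms have gap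
   `0` (`supGap_of_nearFarStep`, by `condMeanGap_zero_of_fibreIndep`); `UniformJunctionSupply → UniformTwoChannelGap →
   UniformNearFarGap → UniformSupGap → UniformGeomDefect` (`uniformTwoChannelGap_of_junctionSupply`,
   `uniformNearFarGap_of_twoChannel` by `two_channel_le`, `uniformSupGap_of_nearFar`, `uniformSupGap_of_junctionSupply`,
   `uniformGeomDefect_of_junctionSupply`).
§4b THE SEPARABILITY CHANNEL DECAYS BY ITSELF.  The pair rate of a string in CLOSED FORM,
   `loopProdRate C₁ θ₁ C₂ θ₂ n (loopWords F K Cs) = C₂·ℓ·θ₂ⁿ + (C₁ℓ)²·(θ₁²)ⁿ`, `ℓ = wordLen Cs` the total word length of the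
   string, the run `K` gone (`loopProdRate_loopWords`); its K-uniform two-channel envelope under caps on the constants
   (`loopProdRate_loopWords_le`); «rate × window ≤ one geometric channel» (`rate_mul_window_le`); the HYPOTHESIS SHAPE
   `UniformSidesSupply D g₀` — geometric law channel `(A₁, r₁ < 1)`, K-UNIFORM caps `(C̄₁, θ̄₁ < 1, C̄₂, θ̄₂ < 1)` on every run's
   b07 constants, a window cap `Δ̄`, near/far — and `UniformSidesSupply → UniformJunctionSupply` with the EXPLICIT separability
   amplitude `Δ̄·(C̄₂ℓ + (C̄₁ℓ)²)` and ratio `max θ̄₂ θ̄₁²` (`uniformJunctionSupply_of_sidesSupply`), `→ UniformSupGap`,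
   `→ UniformGeomDefect`.  In the record's dictionary (`θ₁ ↔ L⁻³·(…)`, `θ₂ ↔` second order) this is the kernel form of «second
   order `θ₂ⁿ` + first order squared `θ₁²ⁿ`»; no value of any rate is asserted.
§4c THE MASS-WEIGHTED JUNCTION (the parent module's budget currency).  HYPOTHESIS SHAPES `WeightedJunctionStep D g₀ Cs a k n` —
   a `TermRep`, an `AvgSide`, per-term budgets `ε_Z` with, for EVERY term, either a `LawSide`/`LawSideLoc` whose two channels sum
   to `≤ ε_Z` or fibre-independence with `0 ≤ ε_Z`, and `Σ_Z ε_Z·∫ρ(Z,·) ≤ a·∫ρ_K` — and `UniformWeightedJunction D g₀`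
   (`a = C·rⁿ`).  THEOREMS: `WeightedJunctionStep → StepGapBudget` (`stepGapBudget_of_weightedJunctionStep`),
   `UniformWeightedJunction → UniformTermwiseGap → UniformGeomDefect` (`uniformTermwiseGap_of_weightedJunction`,
   `uniformGeomDefect_of_weightedJunction`), and `UniformJunctionSupply → UniformWeightedJunction` by the mass identity
   (`uniformWeightedJunction_of_junctionSupply`).  In this currency the factor `|Z′|` of a near term's law channel (the full
   fibre size, as typed) is weighed against the term's mass `∫ρ(Z,·)`; whether Bałaban's large-field suppression pays for it is
   the supplier's question, NOT decided here.
§5 END TO END.  `HasContinuumLimit (D.scheme g₀)` from `UniformJunctionSupply` (resp. `UniformNearFarGap`,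
   `UniformWeightedJunction`) + an injected rate + the ladder good/bad datum (`hasContinuumLimit_of_junction_ladder`,
   `hasContinuumLimit_of_nearFar_ladder`, `hasContinuumLimit_of_weightedJunction_ladder`, through the parent module's
   `hasContinuumLimit_of_supGap_ladder` / `hasContinuumLimit_of_termwise_ladder`); the bundled supplier data
   `JunctionRateTelescopeData` / `WeightedJunctionRateTelescopeData` with `⇒ TermwiseRateTelescopeData` and the targets
   `ym4_torus_continuum_limit_exists/unique/exists'_of_junction`, `ym4_torus_continuum_limit_exists_of_weightedJunction` under
   the cell's explicit prefix `UnderHypotheses (BetaPertHyp D.βfun)` resp. `(DagBinding.EndpointExistence D.C.toB12)`.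

WHAT IS NOT PROVED.  No `TermRep` of Bałaban's realised ℝ-steps; no `AvgSide` for his averaging operations (b07's shapes for
them with K-uniform constants and `θ₁, θ₂ < 1` are NOT PRINTED as typed — `T4AvgDerivBound` header; the one-step origin of
the second-difference shape is the cell's located item L-a, unowned); no `LawSide[Loc]` for any of his terms (GAPS G-ne1p3-1 /
G-ne1p3-2, here RE-TYPED as the fields of `LawSide[Loc]` + the decay `lawChannel ≤ A₁r₁ⁿ` + the window cap — NOT PRINTED, B16
p. 356 defers observables; which reference convention closes the count is pv16's open (ii′)/(ii″), not decided here); no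
near/far predicate is constructed (for loop products it is «a block of a bond of the pulled-back loops meets the fibre»,
whose K-uniform count is the record's §3 (CM) bookkeeping, not re-derived); no rate; no instance of (W2) (`LadderGoodBadRate`,
carried as a binder in §5); NE1′ itself; anything about (B), (B^μ) or the β-functions.  The instance binder
`[∀ K j, DecidableEq (PBond (F.P K) j)]` is bookkeeping as in the parent module.
-/

noncomputable section

open MeasureTheory
open Function (updateFinset)
open scoped BigOperators

namespace Literature.MathematicalPhysics.QuantumFieldTheory.Balaban1983to89.T4UniformDefectJunction

open T4ObservableTelescope T4ObservableTelescopeTwoRun T4UniformDefectWiring T4SeparableFibreExpansion T4Spectator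
open T4Continuum T4AvgSensitivity T4AvgDerivBound T4DressedR T4FirstOrderSize T4CondMeanChannel T4CondMeanChannelInsert

/-! ## §1 The junction one-liner in the kernel: `pullback av k n f = f ∘ iterFrom av k n`, and the pulled-back loop product
of the lane IS pv16's named weight `loopProdW` on the (base site, word) list of the string -/

section PullbackComp

variable {P : Params} {G : Type*} [GaugeGroup G] (av : ∀ j, Averaging P j G)

/-- **`pullback av k n f = f ∘ iterFrom av k n`**: generation 3's cast-free pull-back (outermost averaging peeled first) and
`T4AvgSensitivity.iterFrom` (innermost first) spell the same composite `f ∘ avg_{k+n−1} ∘ ⋯ ∘ avg_k`. [folklore] -/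
theorem pullback_eq_comp_iterFrom (k : ℕ) :
    ∀ (n : ℕ) (f : GaugeField P (k + n) G → ℝ), pullback av k n f = f ∘ iterFrom av k n
  | 0, _ => rfl
  | n + 1, f => by
    show pullback av k n (fun U => f ((av (k + n)).avg U)) = f ∘ iterFrom av k (n + 1)
    rw [pullback_eq_comp_iterFrom k n]
    rfl

/-- Pointwise form. [folklore] -/
theorem pullback_apply (k n : ℕ) (f : GaugeField P (k + n) G → ℝ) (U : GaugeField P k G) :
    pullback av k n f U = f (iterFrom av k n U) := by
  rw [pullback_eq_comp_iterFrom]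
  rfl

end PullbackComp

section Words

variable {F : T4Family} {G : Type*} [GaugeGroup G] [MeasurableSpace G] [HaarData G]

/-- THE (BASE SITE, WORD) LIST OF A STRING OF LOOP LABELS AT RUN `K`: each label's base transported to the top level `T^{(K)}`
(`T4Family.toLevel`) paired with its word — the argument format of pv16's `loopProdW`. [folklore] -/
def loopWords (F : T4Family) (K : ℕ) (Cs : List (ULoop F)) : List (Site (F.P K) K × List (Letter (F.P K).d)) :=
  Cs.map fun C => (F.toLevel K C.1.base, C.1.word)

omit [GaugeGroup G] [MeasurableSpace G] [HaarData G] in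
/-- Every entry of the list is a CLOSED walk (`UWord.IsLoop.walkEnd_atLevel`). [folklore] -/
theorem loopWords_closed (K : ℕ) (Cs : List (ULoop F)) :
    ∀ xw ∈ loopWords F K Cs, walkEnd xw.1 xw.2 = xw.1 := by
  intro xw hxw
  obtain ⟨C, _, rfl⟩ := List.mem_map.mp hxw
  exact C.2.walkEnd_atLevel K

omit [GaugeGroup G] [MeasurableSpace G] [HaarData G] in
/-- The list has one entry per label. [folklore] -/
theorem length_loopWords (K : ℕ) (Cs : List (ULoop F)) : (loopWords F K Cs).length = Cs.length :=
  List.length_map _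

omit [MeasurableSpace G] [HaarData G] in
/-- The plain loop product of a string IS the product of the loop variables along the walks of its (base site, word) list.
[folklore] -/
theorem prodLoop_eq_prod_loopWords (K : ℕ) (Cs : List (ULoop F)) (V : GaugeField (F.P K) K G) :
    prodLoop K Cs V = ((loopWords F K Cs).map fun xw => loopAt V (walk xw.1 xw.2)).prod := by
  simp only [prodLoop, loopWords, List.map_map, Function.comp_def, UWord.atLevel]

/-- The run length exceeds nothing it should not: `(k + 1) + n ≤ m + K` for the run `K = k + 1 + n` of the `K`-th torus
(`(F.P K).K = K`, `(F.P K).m = m`) — the standing level constraint of the `T4AvgDerivBound` shapes is automatic. [folklore] -/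
theorem levels_le (F : T4Family) (k n : ℕ) : k + 1 + n ≤ (F.P (k + 1 + n)).m + (F.P (k + 1 + n)).K := by
  rw [T4Family.P_m, T4Family.P_K]
  exact Nat.le_add_left _ _

/-- **THE JUNCTION ONE-LINER** (pv16's `T4SeparableFibreExpansion` header, item (v): «identification of `loopProdW` with
`T4ObservableTelescopeTwoRun.prodLoop` pulled back by `pullback av k n` is a consumer one-liner»): the lane's weight
`loopPullback D Cs k n` (the loop product of run `k + 1 + n` pulled back to level `k + 1`) IS `loopProdW (D.av (k+1+n)) (k+1) n
(loopWords F (k+1+n) Cs)`. [folklore] -/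
theorem loopPullback_eq_loopProdW (D : FiniteEpsData F G) (Cs : List (ULoop F)) (k n : ℕ) :
    loopPullback D Cs k n = loopProdW (D.av (k + 1 + n)) (k + 1) n (loopWords F (k + 1 + n) Cs) := by
  funext U
  rw [loopProdW_eq_comp]
  show pullback (D.av (k + 1 + n)) (k + 1) n (prodLoop (k + 1 + n) Cs) U = _
  rw [pullback_apply, Function.comp_apply, prodLoop_eq_prod_loopWords]

end Words

/-! ## §2 The per-term junction BY NAME: b07's averaging-side shapes + the two laws' conditional-mean suppression data for the
increment reading + the cover/window binders ⇒ `CondMeanGap` for the lane's weight `loopPullback D Cs k n` -/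

section Term

variable {F : T4Family} {G : Type*} [GaugeGroup G] [MeasurableSpace G] [HaarData G]
variable [∀ K j : ℕ, DecidableEq (PBond (F.P K) j)]

/-- **THE (CM) CHANNEL FOR THE LANE'S WEIGHT, FIXED REFERENCE** — pv16's `condMeanGap_of_loopProd` transported along §1: for
ONE dressed term `(s, ins, old)` at level `k + 1` of the `(k+1+n)`-th torus with the printed provisos, the b07 shapes
`LoopDerivBound` / `LoopPairDerivBound` for the run's averagings `D.av (k+1+n)` on a fibre-convex domain family, the two laws'
`CondMeanSuppression` data for the INCREMENT READING of `loopPullback D Cs k n` at the reference point `(V₀, y₀)`, live-set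
covers, deviation caps and the cover/window binders `Δ₁, Δ₂` give
`CondMeanGap s ins old (loopPullback D Cs k n) ((|s|·lip₁·d₁ + rate·Δ₁) + (|s|·lip₂·d₂ + rate·Δ₂))`,
`rate = loopProdRate C₁ θ₁ C₂ θ₂ n (loopWords F (k+1+n) Cs)`.  Nothing is asserted of Bałaban's densities. [folklore] -/
theorem condMeanGap_loopPullback [RegularGaugeGroup G] (D : FiniteEpsData F G) (hM : D.AvgMeasurable)
    (Cs : List (ULoop F)) (k n : ℕ) {s : Finset (PBond (F.P (k + 1 + n)) (k + 1))}
    {ins old : Density (F.P (k + 1 + n)) (k + 1) G} {C : ℝ} (hP : TermProvisos s ins old C)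
    {dom : ∀ i, Set (GaugeField (F.P (k + 1 + n)) i G)} {C₁ θ₁ C₂ θ₂ : ℝ}
    (hder : LoopDerivBound (D.av (k + 1 + n)) dom C₁ θ₁) (hpair : LoopPairDerivBound (D.av (k + 1 + n)) dom C₂ θ₂)
    (hconv : FibreConvex dom) (hC₁ : 0 ≤ C₁) (hθ₁ : 0 ≤ θ₁) (hC₂ : 0 ≤ C₂) (hθ₂ : 0 ≤ θ₂)
    (V₀ : GaugeField (F.P (k + 1 + n)) (k + 1) G) (y₀ : s → G) (h₀ : updateFinset V₀ s y₀ ∈ dom (k + 1))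
    {dom₁ dom₂ : Set (GaugeField (F.P (k + 1 + n)) (k + 1) G)} {dev₁ dev₂ : GaugeField (F.P (k + 1 + n)) (k + 1) G → ℝ}
    {lip₁ lip₂ d₁ d₂ Δ₁ Δ₂ : ℝ}
    (hsup₁ : CondMeanSuppression dom₁ (condMeanField s old (incrReading s (loopPullback D Cs k n) V₀ y₀))
      Finset.univ dev₁ lip₁)
    (hsup₂ : CondMeanSuppression dom₂ (condMeanField s ins (incrReading s (loopPullback D Cs k n) V₀ y₀))
      Finset.univ dev₂ lip₂)
    (hdom₁ : liveSet s old ⊆ dom₁) (hdom₂ : liveSet s old ⊆ dom₂) (hdev₁ : ∀ V ∈ liveSet s old, dev₁ V ≤ d₁)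
    (hdev₂ : ∀ V ∈ liveSet s old, dev₂ V ≤ d₂) (hlip₁ : 0 ≤ lip₁) (hlip₂ : 0 ≤ lip₂)
    (hcov₁ : ∀ (V : GaugeField (F.P (k + 1 + n)) (k + 1) G) (y : s → G), old (updateFinset V s y) ≠ 0 →
      updateFinset V s y ∈ dom (k + 1) ∧
        (∑ b : s, bdist (y₀ b) (y b)) * tv (updateFinset V₀ s y₀) (updateFinset V s y) ≤ Δ₁)
    (hcov₂ : ∀ V ∈ liveSet s old, ∀ y : s → G, ins (updateFinset V s y) ≠ 0 →
      updateFinset V s y ∈ dom (k + 1) ∧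
        (∑ b : s, bdist (y₀ b) (y b)) * tv (updateFinset V₀ s y₀) (updateFinset V s y) ≤ Δ₂) :
    CondMeanGap s ins old (loopPullback D Cs k n)
      (((s.card : ℝ) * (lip₁ * d₁) + loopProdRate C₁ θ₁ C₂ θ₂ n (loopWords F (k + 1 + n) Cs) * Δ₁)
        + ((s.card : ℝ) * (lip₂ * d₂) + loopProdRate C₁ θ₁ C₂ θ₂ n (loopWords F (k + 1 + n) Cs) * Δ₂)) := by
  rw [loopPullback_eq_loopProdW] at hsup₁ hsup₂ ⊢
  exact condMeanGap_of_loopProd hP (hM (k + 1 + n)) hder hpair hconv hC₁ hθ₁ hC₂ hθ₂ (levels_le F k n)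
    (loopWords F (k + 1 + n) Cs) (loopWords_closed (k + 1 + n) Cs) V₀ y₀ h₀ hsup₁ hsup₂ hdom₁ hdom₂ hdev₁ hdev₂ hlip₁
    hlip₂ hcov₁ hcov₂

/-- **THE (CM) CHANNEL FOR THE LANE'S WEIGHT, LOCAL REFERENCE** — pv16's `condMeanGap_of_loopProdLoc` (v1.1 §4: reference
exterior = the configuration's own; NO exterior term in the window, exterior-DEPENDENT reading `incrReadingLoc`) transported
along §1.  Which of the two conventions closes a count is OPEN (pv16 v1.1 header (ii′)); both are offered. [folklore] -/
theorem condMeanGap_loopPullback_loc [RegularGaugeGroup G] (D : FiniteEpsData F G) (hM : D.AvgMeasurable)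
    (Cs : List (ULoop F)) (k n : ℕ) {s : Finset (PBond (F.P (k + 1 + n)) (k + 1))}
    {ins old : Density (F.P (k + 1 + n)) (k + 1) G} {C : ℝ} (hP : TermProvisos s ins old C)
    {dom : ∀ i, Set (GaugeField (F.P (k + 1 + n)) i G)} {C₁ θ₁ C₂ θ₂ : ℝ}
    (hder : LoopDerivBound (D.av (k + 1 + n)) dom C₁ θ₁) (hpair : LoopPairDerivBound (D.av (k + 1 + n)) dom C₂ θ₂)
    (hconv : FibreConvex dom) (hC₁ : 0 ≤ C₁) (hθ₁ : 0 ≤ θ₁) (hC₂ : 0 ≤ C₂) (hθ₂ : 0 ≤ θ₂) (y₀ : s → G)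
    {dom₁ dom₂ : Set (GaugeField (F.P (k + 1 + n)) (k + 1) G)} {dev₁ dev₂ : GaugeField (F.P (k + 1 + n)) (k + 1) G → ℝ}
    {lip₁ lip₂ d₁ d₂ Δ₁ Δ₂ : ℝ}
    (hsup₁ : CondMeanSuppression dom₁ (condMeanField s old (incrReadingLoc s (loopPullback D Cs k n) y₀))
      Finset.univ dev₁ lip₁)
    (hsup₂ : CondMeanSuppression dom₂ (condMeanField s ins (incrReadingLoc s (loopPullback D Cs k n) y₀))
      Finset.univ dev₂ lip₂)
    (hdom₁ : liveSet s old ⊆ dom₁) (hdom₂ : liveSet s old ⊆ dom₂) (hdev₁ : ∀ V ∈ liveSet s old, dev₁ V ≤ d₁)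
    (hdev₂ : ∀ V ∈ liveSet s old, dev₂ V ≤ d₂) (hlip₁ : 0 ≤ lip₁) (hlip₂ : 0 ≤ lip₂)
    (hcov₁ : ∀ (V : GaugeField (F.P (k + 1 + n)) (k + 1) G) (y : s → G), old (updateFinset V s y) ≠ 0 →
      updateFinset V s y₀ ∈ dom (k + 1) ∧ updateFinset V s y ∈ dom (k + 1) ∧ (∑ b : s, bdist (y₀ b) (y b)) ^ 2 ≤ Δ₁)
    (hcov₂ : ∀ V ∈ liveSet s old, ∀ y : s → G, ins (updateFinset V s y) ≠ 0 →
      updateFinset V s y₀ ∈ dom (k + 1) ∧ updateFinset V s y ∈ dom (k + 1) ∧ (∑ b : s, bdist (y₀ b) (y b)) ^ 2 ≤ Δ₂) :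
    CondMeanGap s ins old (loopPullback D Cs k n)
      (((s.card : ℝ) * (lip₁ * d₁) + loopProdRate C₁ θ₁ C₂ θ₂ n (loopWords F (k + 1 + n) Cs) * Δ₁)
        + ((s.card : ℝ) * (lip₂ * d₂) + loopProdRate C₁ θ₁ C₂ θ₂ n (loopWords F (k + 1 + n) Cs) * Δ₂)) := by
  rw [loopPullback_eq_loopProdW] at hsup₁ hsup₂ ⊢
  exact condMeanGap_of_loopProdLoc hP (hM (k + 1 + n)) hder hpair hconv hC₁ hθ₁ hC₂ hθ₂ (levels_le F k n)
    (loopWords F (k + 1 + n) Cs) (loopWords_closed (k + 1 + n) Cs) y₀ hsup₁ hsup₂ hdom₁ hdom₂ hdev₁ hdev₂ hlip₁ hlip₂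
    hcov₁ hcov₂

end Term

/-! ## §3 The two sides BUNDLED: b07's averaging-side shapes of one run (`AvgSide`), the law side + cover/window of one term
in either reference convention (`LawSide`, `LawSideLoc`), the two channels of the gap, and the increment bound by the
ONE-STEP CONTRACTION (`AvgSide.ofStepContraction`, b07's tower chain rule by name) -/

section AvgSides

variable {P : Params} {G : Type*} [GaugeGroup G]

/-- DATA — THE AVERAGING SIDE OF ONE RUN, bundled (b07's HYPOTHESIS SHAPES of `T4AvgDerivBound`, NOT PRINTED as typed and
never asserted here): a family of regularity domains, the per-bond first-difference shape `LoopDerivBound av dom C₁ θ₁`, the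
second-difference shape `LoopPairDerivBound av dom C₂ θ₂`, fibre-convexity, non-negative constants.  The lane consumes no
other averaging-side modulus (pv16's typing answer to (Q-av-Lip), `T4SeparableFibreExpansion` header, opening paragraph).
[folklore] -/
structure AvgSide (av : ∀ j, Averaging P j G) where
  /-- the regularity domains, one per level -/
  dom : ∀ i, Set (GaugeField P i G)
  /-- first-difference constant -/
  C₁ : ℝ
  /-- first-difference rate per averaging step -/
  θ₁ : ℝ
  /-- second-difference constant -/
  C₂ : ℝ
  /-- second-difference rate per averaging step -/
  θ₂ : ℝ
  /-- b07's first-difference shape -/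
  der : LoopDerivBound av dom C₁ θ₁
  /-- b07's second-difference shape -/
  pair : LoopPairDerivBound av dom C₂ θ₂
  /-- fibre-convexity of the domains -/
  conv : FibreConvex dom
  /-- non-negativity of the constants -/
  C₁_nonneg : 0 ≤ C₁
  /-- non-negativity of the constants -/
  θ₁_nonneg : 0 ≤ θ₁
  /-- non-negativity of the constants -/
  C₂_nonneg : 0 ≤ C₂
  /-- non-negativity of the constants -/
  θ₂_nonneg : 0 ≤ θ₂

namespace AvgSide

variable {av : ∀ j, Averaging P j G}

/-- The pair rate of a (base site, word) list after `n` averaging steps: pv16's `loopProdRate C₁ θ₁ C₂ θ₂ n ws =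
Σᵢ C₂|wᵢ|θ₂ⁿ + (Σᵢ C₁|wᵢ|θ₁ⁿ)²`. [folklore] -/
def rate (A : AvgSide av) (n : ℕ) {σ : Type*} {d : ℕ} (ws : List (σ × List (Letter d))) : ℝ :=
  loopProdRate A.C₁ A.θ₁ A.C₂ A.θ₂ n ws

/-- The pair rate is non-negative. [folklore] -/
theorem rate_nonneg (A : AvgSide av) (n : ℕ) {σ : Type*} {d : ℕ} (ws : List (σ × List (Letter d))) : 0 ≤ A.rate n ws :=
  loopProdRate_nonneg (C₁ := A.C₁) (θ₁ := A.θ₁) A.C₂_nonneg A.θ₂_nonneg n ws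

/-- **THE INCREMENT BOUND BY THE ONE-STEP CONTRACTION** (the seat's assigned technique, b07's tower chain rule modulo gauge
`T4AvgDerivBound.loopDerivBound_of_stepContraction` BY NAME): if loop variables are `Lip`-Lipschitz for the invariant distance
(`ReTrLip`), the domains propagate and are gauge invariant (`DomStable`, `GaugeStable`) and ONE averaging step contracts total
variation modulo a coarse gauge transformation by `θ` (`AvgStepContraction`, NE1a-STEP — NOT PRINTED as typed), then the
first-difference half of the averaging side holds with `(C₁, θ₁) = (Lip, θ)`; the second-difference half stays a binder
(its one-step origin is the cell's located item L-a, unowned). [folklore] -/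
def ofStepContraction {dom : ∀ i, Set (GaugeField P i G)} {Lip θ C₂ θ₂ : ℝ} (hLip : ReTrLip G Lip) (hLip0 : 0 ≤ Lip)
    (hdom : DomStable av dom) (hg : GaugeStable dom) (hstep : AvgStepContraction av dom θ) (hθ : 0 ≤ θ)
    (hconv : FibreConvex dom) (hpair : LoopPairDerivBound av dom C₂ θ₂) (hC₂ : 0 ≤ C₂) (hθ₂ : 0 ≤ θ₂) : AvgSide av where
  dom := dom
  C₁ := Lip
  θ₁ := θ
  C₂ := C₂
  θ₂ := θ₂
  der := loopDerivBound_of_stepContraction hLip hLip0 hdom hg hstep hθ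
  pair := hpair
  conv := hconv
  C₁_nonneg := hLip0
  θ₁_nonneg := hθ
  C₂_nonneg := hC₂
  θ₂_nonneg := hθ₂

/-- The constants of `ofStepContraction` are `(Lip, θ, C₂, θ₂)`. [folklore] -/
theorem ofStepContraction_rate {dom : ∀ i, Set (GaugeField P i G)} {Lip θ C₂ θ₂ : ℝ} (hLip : ReTrLip G Lip)
    (hLip0 : 0 ≤ Lip) (hdom : DomStable av dom) (hg : GaugeStable dom) (hstep : AvgStepContraction av dom θ) (hθ : 0 ≤ θ)
    (hconv : FibreConvex dom) (hpair : LoopPairDerivBound av dom C₂ θ₂) (hC₂ : 0 ≤ C₂) (hθ₂ : 0 ≤ θ₂) (n : ℕ)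
    {σ : Type*} {d : ℕ} (ws : List (σ × List (Letter d))) :
    (ofStepContraction hLip hLip0 hdom hg hstep hθ hconv hpair hC₂ hθ₂).rate n ws = loopProdRate Lip θ C₂ θ₂ n ws :=
  rfl

end AvgSide

end AvgSides

section LawSides

variable {P : Params} {j : ℕ} {G : Type*} [GaugeGroup G] [MeasurableSpace G] [HaarData G] [DecidableEq (PBond P j)]

/-- DATA — THE LAW SIDE + COVER/WINDOW OF ONE TERM `(s, ins, old)` FOR A WEIGHT `g`, FIXED-REFERENCE CONVENTION (the binders
of pv16's `condMeanGap_of_loopProd` after the averaging side, bundled; NOT PRINTED, never asserted here): a reference point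
`(V₀, y₀)` in the domain `domj`; the two laws' `CondMeanSuppression` data for the increment reading `incrReading s g V₀ y₀` on
domains covering the old term's live set with deviations capped there; the cover/window binders `Δ₁` (support of the old law)
and `Δ₂` (support of the insert law at old-live exteriors): «fibre variation × total variation from the reference `≤ Δ`».
[folklore] -/
structure LawSide (s : Finset (PBond P j)) (ins old g : Density P j G) (domj : Set (GaugeField P j G)) where
  /-- reference exterior -/
  V₀ : GaugeField P j G
  /-- reference fibre point -/
  y₀ : s → G
  /-- the reference configuration lies in the domain -/
  ref_mem : updateFinset V₀ s y₀ ∈ domj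
  /-- domain of the old law's suppression datum -/
  dom₁ : Set (GaugeField P j G)
  /-- domain of the insert law's suppression datum -/
  dom₂ : Set (GaugeField P j G)
  /-- deviation functional of the old law's datum -/
  dev₁ : GaugeField P j G → ℝ
  /-- deviation functional of the insert law's datum -/
  dev₂ : GaugeField P j G → ℝ
  /-- Lipschitz modulus, old law -/
  lip₁ : ℝ
  /-- Lipschitz modulus, insert law -/
  lip₂ : ℝ
  /-- deviation cap on the live set, old law -/
  d₁ : ℝ
  /-- deviation cap on the live set, insert law -/
  d₂ : ℝ
  /-- window, old law -/
  Δ₁ : ℝ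
  /-- window, insert law -/
  Δ₂ : ℝ
  /-- conditional-mean suppression of the increment reading under the old law -/
  sup₁ : CondMeanSuppression dom₁ (condMeanField s old (incrReading s g V₀ y₀)) Finset.univ dev₁ lip₁
  /-- conditional-mean suppression of the increment reading under the insert law -/
  sup₂ : CondMeanSuppression dom₂ (condMeanField s ins (incrReading s g V₀ y₀)) Finset.univ dev₂ lip₂
  /-- the old term's live set is covered -/
  live₁ : liveSet s old ⊆ dom₁
  /-- the old term's live set is covered -/
  live₂ : liveSet s old ⊆ dom₂
  /-- deviation cap, old law -/
  dev₁_le : ∀ V ∈ liveSet s old, dev₁ V ≤ d₁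
  /-- deviation cap, insert law -/
  dev₂_le : ∀ V ∈ liveSet s old, dev₂ V ≤ d₂
  /-- non-negativity -/
  lip₁_nonneg : 0 ≤ lip₁
  /-- non-negativity -/
  lip₂_nonneg : 0 ≤ lip₂
  /-- cover/window on the support of the old law -/
  cov₁ : ∀ (V : GaugeField P j G) (y : s → G), old (updateFinset V s y) ≠ 0 →
    updateFinset V s y ∈ domj ∧ (∑ b : s, bdist (y₀ b) (y b)) * tv (updateFinset V₀ s y₀) (updateFinset V s y) ≤ Δ₁
  /-- cover/window on the support of the insert law at old-live exteriors -/
  cov₂ : ∀ V ∈ liveSet s old, ∀ y : s → G, ins (updateFinset V s y) ≠ 0 →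
    updateFinset V s y ∈ domj ∧ (∑ b : s, bdist (y₀ b) (y b)) * tv (updateFinset V₀ s y₀) (updateFinset V s y) ≤ Δ₂

namespace LawSide

variable {s : Finset (PBond P j)} {ins old g : Density P j G} {domj : Set (GaugeField P j G)}

/-- THE FIRST-ORDER (LAW) CHANNEL of the term: `|s|·lip₁·d₁ + |s|·lip₂·d₂` — «(fibre bonds seen) × (conditional-mean
suppression)», the record's `(θ₁φ)ⁿ` channel once the supplier's sizes are in. [folklore] -/
def lawChannel (L : LawSide s ins old g domj) : ℝ := (s.card : ℝ) * (L.lip₁ * L.d₁) + (s.card : ℝ) * (L.lip₂ * L.d₂)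

/-- THE SECOND-ORDER (SEPARABILITY) CHANNEL of the term at pair rate `rate`: `rate·Δ₁ + rate·Δ₂` — the record's `θ₂ⁿ`
channel. [folklore] -/
def sepChannel (L : LawSide s ins old g domj) (rate : ℝ) : ℝ := rate * L.Δ₁ + rate * L.Δ₂

/-- pv16's gap expression is the sum of the two channels. [folklore] -/
theorem total_eq (L : LawSide s ins old g domj) (rate : ℝ) :
    ((s.card : ℝ) * (L.lip₁ * L.d₁) + rate * L.Δ₁) + ((s.card : ℝ) * (L.lip₂ * L.d₂) + rate * L.Δ₂)
      = L.lawChannel + L.sepChannel rate := by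
  unfold lawChannel sepChannel
  ring

/-- «COUNT × SIZE» for the law channel: `|s| ≤ N`, `0 ≤ lip₁·d₁ ≤ e₁`, `0 ≤ lip₂·d₂ ≤ e₂` give `lawChannel ≤ N·(e₁ + e₂)`
— where the number of fibre bonds the term sees enters (record §3 (CM); `T4UniformDefectWiring.count_mul_rate_eq`). [folklore] -/
theorem lawChannel_le (L : LawSide s ins old g domj) {N e₁ e₂ : ℝ} (hN : (s.card : ℝ) ≤ N) (h₁ : L.lip₁ * L.d₁ ≤ e₁)
    (h₂ : L.lip₂ * L.d₂ ≤ e₂) (h₁0 : 0 ≤ L.lip₁ * L.d₁) (h₂0 : 0 ≤ L.lip₂ * L.d₂) :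
    L.lawChannel ≤ N * (e₁ + e₂) := by
  unfold lawChannel
  have hs : (0 : ℝ) ≤ (s.card : ℝ) := Nat.cast_nonneg _
  calc (s.card : ℝ) * (L.lip₁ * L.d₁) + (s.card : ℝ) * (L.lip₂ * L.d₂)
      ≤ N * e₁ + N * e₂ := add_le_add (mul_le_mul hN h₁ h₁0 (hs.trans hN)) (mul_le_mul hN h₂ h₂0 (hs.trans hN))
    _ = N * (e₁ + e₂) := by ring

end LawSide

/-- DATA — THE LAW SIDE + COVER/WINDOW OF ONE TERM, LOCAL-REFERENCE CONVENTION (the binders of pv16's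
`condMeanGap_of_loopProdLoc`, bundled; NOT PRINTED, never asserted here): a reference fibre point `y₀` only; suppression data
for the exterior-DEPENDENT reading `incrReadingLoc s g y₀`; windows «(fibre variation)² ≤ Δ» with both `V ← y₀` and `V ← y` in
the domain — NO exterior term. [folklore] -/
structure LawSideLoc (s : Finset (PBond P j)) (ins old g : Density P j G) (domj : Set (GaugeField P j G)) where
  /-- reference fibre point -/
  y₀ : s → G
  /-- domain of the old law's suppression datum -/
  dom₁ : Set (GaugeField P j G)
  /-- domain of the insert law's suppression datum -/
  dom₂ : Set (GaugeField P j G)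
  /-- deviation functional of the old law's datum -/
  dev₁ : GaugeField P j G → ℝ
  /-- deviation functional of the insert law's datum -/
  dev₂ : GaugeField P j G → ℝ
  /-- Lipschitz modulus, old law -/
  lip₁ : ℝ
  /-- Lipschitz modulus, insert law -/
  lip₂ : ℝ
  /-- deviation cap on the live set, old law -/
  d₁ : ℝ
  /-- deviation cap on the live set, insert law -/
  d₂ : ℝ
  /-- window, old law -/
  Δ₁ : ℝ
  /-- window, insert law -/
  Δ₂ : ℝ
  /-- conditional-mean suppression of the local increment reading under the old law -/
  sup₁ : CondMeanSuppression dom₁ (condMeanField s old (incrReadingLoc s g y₀)) Finset.univ dev₁ lip₁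
  /-- conditional-mean suppression of the local increment reading under the insert law -/
  sup₂ : CondMeanSuppression dom₂ (condMeanField s ins (incrReadingLoc s g y₀)) Finset.univ dev₂ lip₂
  /-- the old term's live set is covered -/
  live₁ : liveSet s old ⊆ dom₁
  /-- the old term's live set is covered -/
  live₂ : liveSet s old ⊆ dom₂
  /-- deviation cap, old law -/
  dev₁_le : ∀ V ∈ liveSet s old, dev₁ V ≤ d₁
  /-- deviation cap, insert law -/
  dev₂_le : ∀ V ∈ liveSet s old, dev₂ V ≤ d₂
  /-- non-negativity -/
  lip₁_nonneg : 0 ≤ lip₁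
  /-- non-negativity -/
  lip₂_nonneg : 0 ≤ lip₂
  /-- cover/window on the support of the old law -/
  cov₁ : ∀ (V : GaugeField P j G) (y : s → G), old (updateFinset V s y) ≠ 0 →
    updateFinset V s y₀ ∈ domj ∧ updateFinset V s y ∈ domj ∧ (∑ b : s, bdist (y₀ b) (y b)) ^ 2 ≤ Δ₁
  /-- cover/window on the support of the insert law at old-live exteriors -/
  cov₂ : ∀ V ∈ liveSet s old, ∀ y : s → G, ins (updateFinset V s y) ≠ 0 →
    updateFinset V s y₀ ∈ domj ∧ updateFinset V s y ∈ domj ∧ (∑ b : s, bdist (y₀ b) (y b)) ^ 2 ≤ Δ₂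

namespace LawSideLoc

variable {s : Finset (PBond P j)} {ins old g : Density P j G} {domj : Set (GaugeField P j G)}

/-- The first-order (law) channel, local convention: `|s|·lip₁·d₁ + |s|·lip₂·d₂`. [folklore] -/
def lawChannel (L : LawSideLoc s ins old g domj) : ℝ := (s.card : ℝ) * (L.lip₁ * L.d₁) + (s.card : ℝ) * (L.lip₂ * L.d₂)

/-- The second-order (separability) channel, local convention: `rate·Δ₁ + rate·Δ₂`. [folklore] -/
def sepChannel (L : LawSideLoc s ins old g domj) (rate : ℝ) : ℝ := rate * L.Δ₁ + rate * L.Δ₂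

/-- pv16's gap expression is the sum of the two channels. [folklore] -/
theorem total_eq (L : LawSideLoc s ins old g domj) (rate : ℝ) :
    ((s.card : ℝ) * (L.lip₁ * L.d₁) + rate * L.Δ₁) + ((s.card : ℝ) * (L.lip₂ * L.d₂) + rate * L.Δ₂)
      = L.lawChannel + L.sepChannel rate := by
  unfold lawChannel sepChannel
  ring

end LawSideLoc

end LawSides

section TermBundled

variable {F : T4Family} {G : Type*} [GaugeGroup G] [MeasurableSpace G] [HaarData G]
variable [∀ K j : ℕ, DecidableEq (PBond (F.P K) j)]

/-- **ONE TERM, BOTH SIDES SUPPLIED ⇒ ITS GAP, FIXED REFERENCE**: `CondMeanGap s ins old (loopPullback D Cs k n)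
(lawChannel + sepChannel (rate n))` (§2 with the bundles of §3). [folklore] -/
theorem condMeanGap_of_sides [RegularGaugeGroup G] (D : FiniteEpsData F G) (hM : D.AvgMeasurable) (Cs : List (ULoop F))
    (k n : ℕ) {s : Finset (PBond (F.P (k + 1 + n)) (k + 1))} {ins old : Density (F.P (k + 1 + n)) (k + 1) G} {C : ℝ}
    (hP : TermProvisos s ins old C) (A : AvgSide (D.av (k + 1 + n)))
    (L : LawSide s ins old (loopPullback D Cs k n) (A.dom (k + 1))) :
    CondMeanGap s ins old (loopPullback D Cs k n) (L.lawChannel + L.sepChannel (A.rate n (loopWords F (k + 1 + n) Cs))) := by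
  rw [← L.total_eq]
  exact condMeanGap_loopPullback D hM Cs k n hP A.der A.pair A.conv A.C₁_nonneg A.θ₁_nonneg A.C₂_nonneg A.θ₂_nonneg
    L.V₀ L.y₀ L.ref_mem L.sup₁ L.sup₂ L.live₁ L.live₂ L.dev₁_le L.dev₂_le L.lip₁_nonneg L.lip₂_nonneg L.cov₁ L.cov₂

/-- **ONE TERM, BOTH SIDES SUPPLIED ⇒ ITS GAP, LOCAL REFERENCE.** [folklore] -/
theorem condMeanGap_of_sidesLoc [RegularGaugeGroup G] (D : FiniteEpsData F G) (hM : D.AvgMeasurable)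
    (Cs : List (ULoop F)) (k n : ℕ) {s : Finset (PBond (F.P (k + 1 + n)) (k + 1))}
    {ins old : Density (F.P (k + 1 + n)) (k + 1) G} {C : ℝ} (hP : TermProvisos s ins old C)
    (A : AvgSide (D.av (k + 1 + n))) (L : LawSideLoc s ins old (loopPullback D Cs k n) (A.dom (k + 1))) :
    CondMeanGap s ins old (loopPullback D Cs k n) (L.lawChannel + L.sepChannel (A.rate n (loopWords F (k + 1 + n) Cs))) := by
  rw [← L.total_eq]
  exact condMeanGap_loopPullback_loc D hM Cs k n hP A.der A.pair A.conv A.C₁_nonneg A.θ₁_nonneg A.C₂_nonneg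
    A.θ₂_nonneg L.y₀ L.sup₁ L.sup₂ L.live₁ L.live₂ L.dev₁_le L.dev₂_le L.lip₁_nonneg L.lip₂_nonneg L.cov₁ L.cov₂

end TermBundled

/-! ## §4 Near/far and decay, to the wall's name: hypothesis shapes one level finer than `UniformSupGap` and the implications
`UniformJunctionSupply → UniformTwoChannelGap → UniformNearFarGap → UniformSupGap (→ UniformGeomDefect)` -/

section NearFar

variable {F : T4Family} {G : Type*} [GaugeGroup G] [MeasurableSpace G] [HaarData G]
variable [∀ K j : ℕ, DecidableEq (PBond (F.P K) j)]

/-- HYPOTHESIS SHAPE — THE NEAR/FAR STEP DATUM WITH GAP `η` at `(Cs, k, n)` (run `K = k + 1 + n`; NOT PRINTED, never asserted):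
a (0.3)-representation of the realised step `(Tρ_k^{(K)}, R_k^{(K)})`, a predicate `near` on its terms, the conditional-mean gap
`η` for the lane's weight on every NEAR term, and FIBRE-INDEPENDENCE of the weight from the fibre of every FAR term (for the
cell's loop products: no block of a bond of the pulled-back loops meets the fibre — `T4DressedR.FibreIndep`).  The hypothesis-
level near/far constructor asked for by the cross-read of the parent module (cell GAPS C-pv01-86, INFO I2). [folklore] -/
def NearFarStep (D : FiniteEpsData F G) (g₀ : ℕ → ℝ) (Cs : List (ULoop F)) (η : ℝ) (k n : ℕ) : Prop :=
  ∃ ρr : TermRep (D.real.Trho (k + 1 + n) (g₀ (k + 1 + n)) k) (D.real.R (k + 1 + n) (g₀ (k + 1 + n)) k),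
    ∃ near : ρr.ι → Prop,
      (∀ Z, near Z → CondMeanGap (ρr.fib Z) (ρr.piece (ρr.pp Z)) (ρr.piece Z) (loopPullback D Cs k n) η) ∧
      (∀ Z, ¬ near Z → FibreIndep (ρr.fib Z) (loopPullback D Cs k n))

/-- The near/far datum is monotone in the gap. [folklore] -/
theorem NearFarStep.mono {D : FiniteEpsData F G} {g₀ : ℕ → ℝ} {Cs : List (ULoop F)} {η η' : ℝ} {k n : ℕ}
    (h : NearFarStep D g₀ Cs η k n) (hle : η ≤ η') : NearFarStep D g₀ Cs η' k n := by
  obtain ⟨ρr, near, hnear, hfar⟩ := h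
  exact ⟨ρr, near, fun Z hZ => condMeanGap_mono (hnear Z hZ) hle, hfar⟩

/-- **NEAR/FAR ⇒ THE UNIFORM PER-TERM GAP** (far terms have gap `0`, `condMeanGap_zero_of_fibreIndep`; `0 ≤ η`). [folklore] -/
theorem supGap_of_nearFarStep (D : FiniteEpsData F G) (g₀ : ℕ → ℝ) (Cs : List (ULoop F)) {η : ℝ} (hη : 0 ≤ η) {k n : ℕ}
    (h : NearFarStep D g₀ Cs η k n) :
    ∃ ρr : TermRep (D.real.Trho (k + 1 + n) (g₀ (k + 1 + n)) k) (D.real.R (k + 1 + n) (g₀ (k + 1 + n)) k),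
      ∀ Z, CondMeanGap (ρr.fib Z) (ρr.piece (ρr.pp Z)) (ρr.piece Z) (loopPullback D Cs k n) η := by
  classical
  obtain ⟨ρr, near, hnear, hfar⟩ := h
  refine ⟨ρr, fun Z => ?_⟩
  by_cases hZ : near Z
  · exact hnear Z hZ
  · exact condMeanGap_mono (condMeanGap_zero_of_fibreIndep (ρr.provisos Z) (hfar Z hZ)) hη

/-- HYPOTHESIS SHAPE — (W1) IN NEAR/FAR FORM: per string, `0 ≤ C`, `0 ≤ r < 1` and the near/far datum with gap `C·rⁿ` for every
`(k, n)`. [folklore] -/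
def UniformNearFarGap (D : FiniteEpsData F G) (g₀ : ℕ → ℝ) : Prop :=
  ∀ Cs : List (ULoop F), ∃ C r : ℝ, 0 ≤ C ∧ 0 ≤ r ∧ r < 1 ∧ ∀ k n, NearFarStep D g₀ Cs (C * r ^ n) k n

/-- **`UniformNearFarGap → UniformSupGap`** (the parent module's wall, BY NAME). [folklore] -/
theorem uniformSupGap_of_nearFar (D : FiniteEpsData F G) (g₀ : ℕ → ℝ) (h : UniformNearFarGap D g₀) :
    UniformSupGap D g₀ := by
  intro Cs
  obtain ⟨C, r, hC, hr0, hr1, hkn⟩ := h Cs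
  exact ⟨C, r, hC, hr0, hr1, fun k n => supGap_of_nearFarStep D g₀ Cs (mul_nonneg hC (pow_nonneg hr0 n)) (hkn k n)⟩

/-- HYPOTHESIS SHAPE — (W1) WITH THE TWO CHANNELS OF THE RECORD'S (CM) VERDICT KEPT APART: per string, two amplitude/ratio pairs
`(A₁, r₁)` (first order, the record's `L⁴θ₁φ` channel) and `(A₂, r₂)` (second order, `L⁴θ₂`), both ratios `< 1`, and the
near/far datum with gap `A₁r₁ⁿ + A₂r₂ⁿ` for every `(k, n)`.  No ratio is asserted. [folklore] -/
def UniformTwoChannelGap (D : FiniteEpsData F G) (g₀ : ℕ → ℝ) : Prop :=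
  ∀ Cs : List (ULoop F), ∃ A₁ r₁ A₂ r₂ : ℝ, 0 ≤ A₁ ∧ 0 ≤ r₁ ∧ r₁ < 1 ∧ 0 ≤ A₂ ∧ 0 ≤ r₂ ∧ r₂ < 1 ∧
    ∀ k n, NearFarStep D g₀ Cs (A₁ * r₁ ^ n + A₂ * r₂ ^ n) k n

/-- **TWO CHANNELS ⇒ ONE** (`two_channel_le`: `C = A₁ + A₂`, `r = max r₁ r₂ < 1`). [folklore] -/
theorem uniformNearFarGap_of_twoChannel (D : FiniteEpsData F G) (g₀ : ℕ → ℝ) (h : UniformTwoChannelGap D g₀) :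
    UniformNearFarGap D g₀ := by
  intro Cs
  obtain ⟨A₁, r₁, A₂, r₂, hA₁, hr₁, hr₁1, hA₂, hr₂, hr₂1, hkn⟩ := h Cs
  exact ⟨A₁ + A₂, max r₁ r₂, add_nonneg hA₁ hA₂, hr₁.trans (le_max_left _ _), max_lt_one hr₁1 hr₂1,
    fun k n => (hkn k n).mono (two_channel_le hA₁ hA₂ hr₁ hr₂ n)⟩

/-- … hence `UniformTwoChannelGap → UniformSupGap`. [folklore] -/
theorem uniformSupGap_of_twoChannel (D : FiniteEpsData F G) (g₀ : ℕ → ℝ) (h : UniformTwoChannelGap D g₀) :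
    UniformSupGap D g₀ :=
  uniformSupGap_of_nearFar D g₀ (uniformNearFarGap_of_twoChannel D g₀ h)

/-- HYPOTHESIS SHAPE — THE JUNCTION STEP DATUM at `(Cs, k, n)` with channel budgets `(a₁, a₂)` (NOT PRINTED, never asserted;
GAPS G-ne1p3-1 / G-ne1p3-2 RE-TYPED one level finer): a (0.3)-representation of the realised step, b07's averaging side of the
run `k + 1 + n` (`AvgSide`), a predicate `near`, for every NEAR term a law-side + cover/window bundle in EITHER reference
convention (`LawSide` / `LawSideLoc`, on the averaging side's level-`(k+1)` domain) whose law channel is `≤ a₁` and whose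
separability channel at the run's pair rate is `≤ a₂`, and fibre-independence of the weight on every FAR term. [folklore] -/
def JunctionStep (D : FiniteEpsData F G) (g₀ : ℕ → ℝ) (Cs : List (ULoop F)) (a₁ a₂ : ℝ) (k n : ℕ) : Prop :=
  ∃ (ρr : TermRep (D.real.Trho (k + 1 + n) (g₀ (k + 1 + n)) k) (D.real.R (k + 1 + n) (g₀ (k + 1 + n)) k))
    (A : AvgSide (D.av (k + 1 + n))) (near : ρr.ι → Prop),
    (∀ Z, near Z →
      (∃ L : LawSide (ρr.fib Z) (ρr.piece (ρr.pp Z)) (ρr.piece Z) (loopPullback D Cs k n) (A.dom (k + 1)),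
          L.lawChannel ≤ a₁ ∧ L.sepChannel (A.rate n (loopWords F (k + 1 + n) Cs)) ≤ a₂) ∨
      (∃ L : LawSideLoc (ρr.fib Z) (ρr.piece (ρr.pp Z)) (ρr.piece Z) (loopPullback D Cs k n) (A.dom (k + 1)),
          L.lawChannel ≤ a₁ ∧ L.sepChannel (A.rate n (loopWords F (k + 1 + n) Cs)) ≤ a₂)) ∧
    (∀ Z, ¬ near Z → FibreIndep (ρr.fib Z) (loopPullback D Cs k n))

/-- **THE JUNCTION STEP DATUM IS A NEAR/FAR DATUM WITH GAP `a₁ + a₂`** (§3's `condMeanGap_of_sides[Loc]` on every near term,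
monotonicity). [folklore] -/
theorem nearFarStep_of_junctionStep [RegularGaugeGroup G] (D : FiniteEpsData F G) (hM : D.AvgMeasurable) (g₀ : ℕ → ℝ)
    (Cs : List (ULoop F)) {a₁ a₂ : ℝ} {k n : ℕ} (h : JunctionStep D g₀ Cs a₁ a₂ k n) :
    NearFarStep D g₀ Cs (a₁ + a₂) k n := by
  obtain ⟨ρr, A, near, hnear, hfar⟩ := h
  refine ⟨ρr, near, fun Z hZ => ?_, hfar⟩
  rcases hnear Z hZ with ⟨L, h₁, h₂⟩ | ⟨L, h₁, h₂⟩
  · exact condMeanGap_mono (condMeanGap_of_sides D hM Cs k n (ρr.provisos Z) A L) (add_le_add h₁ h₂)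
  · exact condMeanGap_mono (condMeanGap_of_sidesLoc D hM Cs k n (ρr.provisos Z) A L) (add_le_add h₁ h₂)

/-- HYPOTHESIS SHAPE — (W1) AS A JUNCTION SUPPLY: per string, two amplitude/ratio pairs with ratios `< 1` and the junction step
datum with channel budgets `(A₁r₁ⁿ, A₂r₂ⁿ)` for every `(k, n)`.  THIS is the typed form, one level finer than the parent
module's `UniformSupGap`, of the lane's open input (W1): what a supplier seat must produce for Bałaban's data is (a) the
representation, (b) the b07 shapes for his averagings with K-uniform `(C₁, θ₁, C₂, θ₂)`, (c) per near term the law-side data,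
(d) the DECAY of the two channels in the scale distance `n` — none of which this module asserts. [folklore] -/
def UniformJunctionSupply (D : FiniteEpsData F G) (g₀ : ℕ → ℝ) : Prop :=
  ∀ Cs : List (ULoop F), ∃ A₁ r₁ A₂ r₂ : ℝ, 0 ≤ A₁ ∧ 0 ≤ r₁ ∧ r₁ < 1 ∧ 0 ≤ A₂ ∧ 0 ≤ r₂ ∧ r₂ < 1 ∧
    ∀ k n, JunctionStep D g₀ Cs (A₁ * r₁ ^ n) (A₂ * r₂ ^ n) k n

/-- **`UniformJunctionSupply → UniformTwoChannelGap`.** [folklore] -/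
theorem uniformTwoChannelGap_of_junctionSupply [RegularGaugeGroup G] (D : FiniteEpsData F G) (hM : D.AvgMeasurable)
    (g₀ : ℕ → ℝ) (h : UniformJunctionSupply D g₀) : UniformTwoChannelGap D g₀ := by
  intro Cs
  obtain ⟨A₁, r₁, A₂, r₂, hA₁, hr₁, hr₁1, hA₂, hr₂, hr₂1, hkn⟩ := h Cs
  exact ⟨A₁, r₁, A₂, r₂, hA₁, hr₁, hr₁1, hA₂, hr₂, hr₂1, fun k n => nearFarStep_of_junctionStep D hM g₀ Cs (hkn k n)⟩

/-- **`UniformJunctionSupply → UniformSupGap`** — the parent module's wall (W1) from the junction supply, BY NAME. [folklore] -/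
theorem uniformSupGap_of_junctionSupply [RegularGaugeGroup G] (D : FiniteEpsData F G) (hM : D.AvgMeasurable)
    (g₀ : ℕ → ℝ) (h : UniformJunctionSupply D g₀) : UniformSupGap D g₀ :=
  uniformSupGap_of_twoChannel D g₀ (uniformTwoChannelGap_of_junctionSupply D hM g₀ h)

/-- **`UniformJunctionSupply → UniformGeomDefect`** (generation 2's (W1), through the parent module). [folklore] -/
theorem uniformGeomDefect_of_junctionSupply [RegularGaugeGroup G] (D : FiniteEpsData F G) (hM : D.AvgMeasurable)
    (g₀ : ℕ → ℝ) (h : UniformJunctionSupply D g₀) : UniformGeomDefect D g₀ :=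
  uniformGeomDefect_of_supGap D hM g₀ (uniformSupGap_of_junctionSupply D hM g₀ h)

end NearFar

/-! ## §4b The separability channel decays BY ITSELF at the averaging side's rates: the pair rate of a string in closed form,
`rate = C₂·ℓ·θ₂ⁿ + (C₁ℓ)²·(θ₁²)ⁿ` (`ℓ` = total word length of the string, independent of the run), and (W1) as UNIFORM SIDES
— K-uniform b07 constants with `θ₁, θ₂ < 1`, a uniform window cap, a geometric law channel ⇒ `UniformJunctionSupply` with the
explicit amplitude `Δ̄·(C̄₂ℓ + (C̄₁ℓ)²)` and ratio `max θ̄₂ θ̄₁²` on the separability channel -/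

section UniformSides

variable {F : T4Family} {G : Type*} [GaugeGroup G] [MeasurableSpace G] [HaarData G]
variable [∀ K j : ℕ, DecidableEq (PBond (F.P K) j)]

/-- THE TOTAL WORD LENGTH OF A STRING OF LOOP LABELS, `ℓ(Cs) = Σ_{C ∈ Cs} |word C|` — a datum of the labels, independent of the
run `K` and of the level. [folklore] -/
def wordLen (Cs : List (ULoop F)) : ℝ := (Cs.map fun C => (C.1.word.length : ℝ)).sum

omit [GaugeGroup G] [MeasurableSpace G] [HaarData G] [∀ K j : ℕ, DecidableEq (PBond (F.P K) j)] in
/-- The total word length is non-negative. [folklore] -/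
theorem wordLen_nonneg (Cs : List (ULoop F)) : 0 ≤ wordLen (F := F) Cs :=
  List.sum_nonneg (by
    intro x hx
    obtain ⟨C, _, rfl⟩ := List.mem_map.mp hx
    exact Nat.cast_nonneg _)

omit [GaugeGroup G] [MeasurableSpace G] [HaarData G] [∀ K j : ℕ, DecidableEq (PBond (F.P K) j)] in
/-- `Σ (a · f x · b) = a · (Σ f x) · b` over a list. [folklore] -/
theorem sum_map_const_mul_mul_const {α : Type*} (l : List α) (f : α → ℝ) (a b : ℝ) :
    (l.map fun x => a * f x * b).sum = a * (l.map f).sum * b := by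
  induction l with
  | nil => simp
  | cons x l ih => simp only [List.map_cons, List.sum_cons, ih]; ring

omit [GaugeGroup G] [MeasurableSpace G] [HaarData G] [∀ K j : ℕ, DecidableEq (PBond (F.P K) j)] in
/-- **THE PAIR RATE OF A STRING IN CLOSED FORM**: `loopProdRate C₁ θ₁ C₂ θ₂ n (loopWords F K Cs) = C₂·ℓ·θ₂ⁿ + (C₁·ℓ)²·(θ₁²)ⁿ`,
`ℓ = wordLen Cs` — two GEOMETRIC channels with ratios `θ₂` and `θ₁²`, amplitudes fixed by the string; the run `K` has dropped
out.  (The record's count «second order `θ₂ⁿ` + first order squared `θ₁²ⁿ`», kernel-checked as an identity of the typed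
rate; no value of `θ₁, θ₂` asserted.) [folklore] -/
theorem loopProdRate_loopWords (C₁ θ₁ C₂ θ₂ : ℝ) (n K : ℕ) (Cs : List (ULoop F)) :
    loopProdRate C₁ θ₁ C₂ θ₂ n (loopWords F K Cs) = C₂ * wordLen Cs * θ₂ ^ n + (C₁ * wordLen Cs) ^ 2 * (θ₁ ^ 2) ^ n := by
  have h : ∀ a b : ℝ, ((loopWords F K Cs).map fun xw => a * (xw.2.length : ℝ) * b).sum
      = a * (Cs.map fun C => (C.1.word.length : ℝ)).sum * b := by
    intro a b
    have hl : ((loopWords F K Cs).map fun xw => a * (xw.2.length : ℝ) * b)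
        = Cs.map fun C => a * (C.1.word.length : ℝ) * b := by
      simp only [loopWords, List.map_map, Function.comp_def]
      rfl
    rw [hl]
    exact sum_map_const_mul_mul_const Cs _ a b
  unfold loopProdRate wordLen
  rw [h C₂ (θ₂ ^ n), h C₁ (θ₁ ^ n)]
  ring

omit [GaugeGroup G] [MeasurableSpace G] [HaarData G] [∀ K j : ℕ, DecidableEq (PBond (F.P K) j)] in
/-- **MONOTONE ENVELOPE**: with `0 ≤ C₁ ≤ C̄₁`, `0 ≤ θ₁ ≤ θ̄₁`, `0 ≤ C₂ ≤ C̄₂`, `0 ≤ θ₂ ≤ θ̄₂` the pair rate of the string is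
`≤ C̄₂·ℓ·θ̄₂ⁿ + (C̄₁·ℓ)²·(θ̄₁²)ⁿ` — K-UNIFORM b07 constants give a K-uniform two-channel geometric envelope. [folklore] -/
theorem loopProdRate_loopWords_le {C₁ θ₁ C₂ θ₂ Cb₁ θb₁ Cb₂ θb₂ : ℝ} (hC₁ : 0 ≤ C₁) (hC₁le : C₁ ≤ Cb₁) (hθ₁ : 0 ≤ θ₁)
    (hθ₁le : θ₁ ≤ θb₁) (hC₂ : 0 ≤ C₂) (hC₂le : C₂ ≤ Cb₂) (hθ₂ : 0 ≤ θ₂) (hθ₂le : θ₂ ≤ θb₂) (n K : ℕ)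
    (Cs : List (ULoop F)) :
    loopProdRate C₁ θ₁ C₂ θ₂ n (loopWords F K Cs)
      ≤ Cb₂ * wordLen Cs * θb₂ ^ n + (Cb₁ * wordLen Cs) ^ 2 * (θb₁ ^ 2) ^ n := by
  rw [loopProdRate_loopWords]
  have hℓ : 0 ≤ wordLen (F := F) Cs := wordLen_nonneg Cs
  refine add_le_add ?_ ?_
  · exact mul_le_mul (mul_le_mul_of_nonneg_right hC₂le hℓ) (pow_le_pow_left₀ hθ₂ hθ₂le n) (pow_nonneg hθ₂ n)
      (mul_nonneg (hC₂.trans hC₂le) hℓ)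
  · exact mul_le_mul (pow_le_pow_left₀ (mul_nonneg hC₁ hℓ) (mul_le_mul_of_nonneg_right hC₁le hℓ) 2)
      (pow_le_pow_left₀ (sq_nonneg θ₁) (pow_le_pow_left₀ hθ₁ hθ₁le 2) n) (pow_nonneg (sq_nonneg θ₁) n) (sq_nonneg _)

omit [GaugeGroup G] [MeasurableSpace G] [HaarData G] [∀ K j : ℕ, DecidableEq (PBond (F.P K) j)] in
/-- Bookkeeping: «rate × window» under a two-channel envelope of the rate and a cap on the window is one geometric channel,
`rate·Δ ≤ Δ̄·(B₂ + B₁)·(max ρ₂ ρ₁)ⁿ`. [folklore] -/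
theorem rate_mul_window_le {rate Δ Δb B₂ ρ₂ B₁ ρ₁ : ℝ} (n : ℕ) (hrate0 : 0 ≤ rate)
    (hrate : rate ≤ B₂ * ρ₂ ^ n + B₁ * ρ₁ ^ n) (hΔ : Δ ≤ Δb) (hΔb : 0 ≤ Δb) (hB₂ : 0 ≤ B₂) (hB₁ : 0 ≤ B₁) (hρ₂ : 0 ≤ ρ₂)
    (hρ₁ : 0 ≤ ρ₁) : rate * Δ ≤ Δb * (B₂ + B₁) * max ρ₂ ρ₁ ^ n :=
  calc rate * Δ ≤ rate * Δb := mul_le_mul_of_nonneg_left hΔ hrate0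
    _ ≤ (B₂ * ρ₂ ^ n + B₁ * ρ₁ ^ n) * Δb := mul_le_mul_of_nonneg_right hrate hΔb
    _ ≤ (B₂ + B₁) * max ρ₂ ρ₁ ^ n * Δb := mul_le_mul_of_nonneg_right (two_channel_le hB₂ hB₁ hρ₂ hρ₁ n) hΔb
    _ = Δb * (B₂ + B₁) * max ρ₂ ρ₁ ^ n := by ring

/-- HYPOTHESIS SHAPE — (W1) AS UNIFORM SIDES (NOT PRINTED, never asserted; the instruction's «μ-uniform constants» made a
binder): per string, a geometric LAW channel `(A₁, r₁ < 1)`, K-UNIFORM caps `(C̄₁, θ̄₁ < 1, C̄₂, θ̄₂ < 1)` on the b07 constants of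
every run's averaging side, a uniform window cap `Δ̄`, and for every `(k, n)` the representation, the averaging side with
constants under the caps, the near/far predicate, per near term a law-side bundle (either convention) with law channel
`≤ A₁r₁ⁿ` and window sum `≤ Δ̄`, fibre-independence on far terms.  The separability channel is NOT assumed to decay: it does,
by `loopProdRate_loopWords_le`. [folklore] -/
def UniformSidesSupply (D : FiniteEpsData F G) (g₀ : ℕ → ℝ) : Prop :=
  ∀ Cs : List (ULoop F), ∃ A₁ r₁ Cb₁ θb₁ Cb₂ θb₂ Δb : ℝ, 0 ≤ A₁ ∧ 0 ≤ r₁ ∧ r₁ < 1 ∧ 0 ≤ Cb₁ ∧ 0 ≤ θb₁ ∧ θb₁ < 1 ∧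
    0 ≤ Cb₂ ∧ 0 ≤ θb₂ ∧ θb₂ < 1 ∧ 0 ≤ Δb ∧
    ∀ k n, ∃ (ρr : TermRep (D.real.Trho (k + 1 + n) (g₀ (k + 1 + n)) k) (D.real.R (k + 1 + n) (g₀ (k + 1 + n)) k))
      (A : AvgSide (D.av (k + 1 + n))) (near : ρr.ι → Prop),
      A.C₁ ≤ Cb₁ ∧ A.θ₁ ≤ θb₁ ∧ A.C₂ ≤ Cb₂ ∧ A.θ₂ ≤ θb₂ ∧
      (∀ Z, near Z →
        (∃ L : LawSide (ρr.fib Z) (ρr.piece (ρr.pp Z)) (ρr.piece Z) (loopPullback D Cs k n) (A.dom (k + 1)),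
            L.lawChannel ≤ A₁ * r₁ ^ n ∧ L.Δ₁ + L.Δ₂ ≤ Δb) ∨
        (∃ L : LawSideLoc (ρr.fib Z) (ρr.piece (ρr.pp Z)) (ρr.piece Z) (loopPullback D Cs k n) (A.dom (k + 1)),
            L.lawChannel ≤ A₁ * r₁ ^ n ∧ L.Δ₁ + L.Δ₂ ≤ Δb)) ∧
      (∀ Z, ¬ near Z → FibreIndep (ρr.fib Z) (loopPullback D Cs k n))

/-- **UNIFORM SIDES ⇒ THE JUNCTION SUPPLY, WITH EXPLICIT SEPARABILITY AMPLITUDE AND RATIO**: law channel `(A₁, r₁)` as given;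
separability channel amplitude `Δ̄·(C̄₂ℓ + (C̄₁ℓ)²)`, ratio `max θ̄₂ θ̄₁² < 1` (`ℓ = wordLen Cs`). [folklore] -/
theorem uniformJunctionSupply_of_sidesSupply (D : FiniteEpsData F G) (g₀ : ℕ → ℝ) (h : UniformSidesSupply D g₀) :
    UniformJunctionSupply D g₀ := by
  intro Cs
  obtain ⟨A₁, r₁, Cb₁, θb₁, Cb₂, θb₂, Δb, hA₁, hr₁, hr₁1, hCb₁, hθb₁, hθb₁1, hCb₂, hθb₂, hθb₂1, hΔb, hkn⟩ := h Cs
  have hℓ : 0 ≤ wordLen (F := F) Cs := wordLen_nonneg Cs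
  have hsq1 : θb₁ ^ 2 < 1 := by nlinarith
  refine ⟨A₁, r₁, Δb * (Cb₂ * wordLen Cs + (Cb₁ * wordLen Cs) ^ 2), max θb₂ (θb₁ ^ 2), hA₁, hr₁, hr₁1,
    mul_nonneg hΔb (add_nonneg (mul_nonneg hCb₂ hℓ) (sq_nonneg _)), hθb₂.trans (le_max_left _ _),
    max_lt_one hθb₂1 hsq1, fun k n => ?_⟩
  obtain ⟨ρr, A, near, hC₁, hθ₁, hC₂, hθ₂, hnear, hfar⟩ := hkn k n
  have hrate : A.rate n (loopWords F (k + 1 + n) Cs)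
      ≤ Cb₂ * wordLen Cs * θb₂ ^ n + (Cb₁ * wordLen Cs) ^ 2 * (θb₁ ^ 2) ^ n :=
    loopProdRate_loopWords_le A.C₁_nonneg hC₁ A.θ₁_nonneg hθ₁ A.C₂_nonneg hC₂ A.θ₂_nonneg hθ₂ n (k + 1 + n) Cs
  have hrate0 : 0 ≤ A.rate n (loopWords F (k + 1 + n) Cs) := A.rate_nonneg n _
  have hsep : ∀ {Δ : ℝ}, Δ ≤ Δb → A.rate n (loopWords F (k + 1 + n) Cs) * Δ
      ≤ Δb * (Cb₂ * wordLen Cs + (Cb₁ * wordLen Cs) ^ 2) * max θb₂ (θb₁ ^ 2) ^ n := fun hΔ =>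
    rate_mul_window_le n hrate0 hrate hΔ hΔb (mul_nonneg hCb₂ hℓ) (sq_nonneg _) hθb₂ (sq_nonneg _)
  refine ⟨ρr, A, near, fun Z hZ => ?_, hfar⟩
  rcases hnear Z hZ with ⟨L, hlaw, hΔ⟩ | ⟨L, hlaw, hΔ⟩
  · refine Or.inl ⟨L, hlaw, ?_⟩
    rw [LawSide.sepChannel, ← mul_add]
    exact hsep hΔ
  · refine Or.inr ⟨L, hlaw, ?_⟩
    rw [LawSideLoc.sepChannel, ← mul_add]
    exact hsep hΔ

/-- **UNIFORM SIDES ⇒ `UniformSupGap`** — (W1) BY NAME from K-uniform b07 constants, a geometric law channel and a window cap;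
overall amplitude `A₁ + Δ̄·(C̄₂ℓ + (C̄₁ℓ)²)`, ratio `max r₁ (max θ̄₂ θ̄₁²)`. [folklore] -/
theorem uniformSupGap_of_sidesSupply [RegularGaugeGroup G] (D : FiniteEpsData F G) (hM : D.AvgMeasurable) (g₀ : ℕ → ℝ)
    (h : UniformSidesSupply D g₀) : UniformSupGap D g₀ :=
  uniformSupGap_of_junctionSupply D hM g₀ (uniformJunctionSupply_of_sidesSupply D g₀ h)

/-- **UNIFORM SIDES ⇒ `UniformGeomDefect`.** [folklore] -/
theorem uniformGeomDefect_of_sidesSupply [RegularGaugeGroup G] (D : FiniteEpsData F G) (hM : D.AvgMeasurable)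
    (g₀ : ℕ → ℝ) (h : UniformSidesSupply D g₀) : UniformGeomDefect D g₀ :=
  uniformGeomDefect_of_junctionSupply D hM g₀ (uniformJunctionSupply_of_sidesSupply D g₀ h)

end UniformSides

/-! ## §4c The MASS-WEIGHTED junction (the parent module's budget currency `StepGapBudget` / `UniformTermwiseGap`): per-term
budgets `ε_Z ≥ lawChannel_Z + sepChannel_Z` on supplied terms, `ε_Z ≥ 0` on fibre-independent terms, and ONE inequality
`Σ_Z ε_Z·∫ρ(Z,·) ≤ a·∫ρ_K` — the currency in which a term with a LARGE fibre (its law channel carries the factor `|Z′|`) pays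
with its SMALL mass instead of having to meet a uniform gap -/

section Weighted

variable {F : T4Family} {G : Type*} [GaugeGroup G] [MeasurableSpace G] [HaarData G]
variable [∀ K j : ℕ, DecidableEq (PBond (F.P K) j)]

/-- HYPOTHESIS SHAPE — THE MASS-WEIGHTED JUNCTION STEP DATUM at `(Cs, k, n)` with budget `a` (NOT PRINTED, never asserted): a
(0.3)-representation of the realised step, b07's averaging side of the run, per-term budgets `ε_Z`, for EVERY term either a
law-side bundle (either convention) whose two channels sum to `≤ ε_Z`, or fibre-independence of the weight with `0 ≤ ε_Z`,
and the mass-weighted budget `Σ_Z ε_Z·∫ρ(Z,·) ≤ a·∫ρ_K^{(K)}`.  (The parent module's `StepGapBudget` with the gaps supplied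
through the junction; large-fibre terms are paid for by their masses, which the uniform currency of §4 cannot do.)
[folklore] -/
def WeightedJunctionStep (D : FiniteEpsData F G) (g₀ : ℕ → ℝ) (Cs : List (ULoop F)) (a : ℝ) (k n : ℕ) : Prop :=
  ∃ (ρr : TermRep (D.real.Trho (k + 1 + n) (g₀ (k + 1 + n)) k) (D.real.R (k + 1 + n) (g₀ (k + 1 + n)) k))
    (A : AvgSide (D.av (k + 1 + n))) (ε : ρr.ι → ℝ),
    (∀ Z,
      (∃ L : LawSide (ρr.fib Z) (ρr.piece (ρr.pp Z)) (ρr.piece Z) (loopPullback D Cs k n) (A.dom (k + 1)),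
          L.lawChannel + L.sepChannel (A.rate n (loopWords F (k + 1 + n) Cs)) ≤ ε Z) ∨
      (∃ L : LawSideLoc (ρr.fib Z) (ρr.piece (ρr.pp Z)) (ρr.piece Z) (loopPullback D Cs k n) (A.dom (k + 1)),
          L.lawChannel + L.sepChannel (A.rate n (loopWords F (k + 1 + n) Cs)) ≤ ε Z) ∨
      (FibreIndep (ρr.fib Z) (loopPullback D Cs k n) ∧ 0 ≤ ε Z)) ∧
    ∑ Z, ε Z * ∫ V, ρr.piece Z V ∂fieldMeasure (F.P (k + 1 + n)) (k + 1) G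
      ≤ a * ∫ V, rho D (k + 1 + n) (g₀ (k + 1 + n)) (k + 1 + n) V ∂fieldMeasure (F.P (k + 1 + n)) (k + 1 + n) G

/-- **THE MASS-WEIGHTED JUNCTION DATUM IS A `StepGapBudget`** (§3's `condMeanGap_of_sides[Loc]` or the far-term gap `0`, per
term; the budget inequality verbatim). [folklore] -/
theorem stepGapBudget_of_weightedJunctionStep [RegularGaugeGroup G] (D : FiniteEpsData F G) (hM : D.AvgMeasurable)
    (g₀ : ℕ → ℝ) (Cs : List (ULoop F)) {a : ℝ} {k n : ℕ} (h : WeightedJunctionStep D g₀ Cs a k n) :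
    StepGapBudget D g₀ Cs a k n := by
  obtain ⟨ρr, A, ε, hterm, hbud⟩ := h
  refine ⟨ρr, ε, fun Z => ?_, hbud⟩
  rcases hterm Z with ⟨L, hL⟩ | ⟨L, hL⟩ | ⟨hI, hε⟩
  · exact condMeanGap_mono (condMeanGap_of_sides D hM Cs k n (ρr.provisos Z) A L) hL
  · exact condMeanGap_mono (condMeanGap_of_sidesLoc D hM Cs k n (ρr.provisos Z) A L) hL
  · exact condMeanGap_mono (condMeanGap_zero_of_fibreIndep (ρr.provisos Z) hI) hε

/-- HYPOTHESIS SHAPE — (W1) AS A MASS-WEIGHTED JUNCTION SUPPLY: per string, `0 ≤ C`, `0 ≤ r < 1` and the mass-weighted junction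
datum with budget `C·rⁿ` for every `(k, n)`. [folklore] -/
def UniformWeightedJunction (D : FiniteEpsData F G) (g₀ : ℕ → ℝ) : Prop :=
  ∀ Cs : List (ULoop F), ∃ C r : ℝ, 0 ≤ C ∧ 0 ≤ r ∧ r < 1 ∧ ∀ k n, WeightedJunctionStep D g₀ Cs (C * r ^ n) k n

/-- **`UniformWeightedJunction → UniformTermwiseGap`** (the parent module's termwise form of (W1), BY NAME). [folklore] -/
theorem uniformTermwiseGap_of_weightedJunction [RegularGaugeGroup G] (D : FiniteEpsData F G) (hM : D.AvgMeasurable)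
    (g₀ : ℕ → ℝ) (h : UniformWeightedJunction D g₀) : UniformTermwiseGap D g₀ := by
  intro Cs
  obtain ⟨C, r, hC, hr0, hr1, hkn⟩ := h Cs
  exact ⟨C, r, hC, hr0, hr1, fun k n => stepGapBudget_of_weightedJunctionStep D hM g₀ Cs (hkn k n)⟩

/-- **`UniformWeightedJunction → UniformGeomDefect`.** [folklore] -/
theorem uniformGeomDefect_of_weightedJunction [RegularGaugeGroup G] (D : FiniteEpsData F G) (hM : D.AvgMeasurable)
    (g₀ : ℕ → ℝ) (h : UniformWeightedJunction D g₀) : UniformGeomDefect D g₀ :=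
  uniformGeomDefect_of_termwise D hM g₀ (uniformTermwiseGap_of_weightedJunction D hM g₀ h)

/-- The uniform junction supply of §4 is a mass-weighted one with the constant budget `ε_Z = A₁r₁ⁿ + A₂r₂ⁿ` merged to
`(A₁ + A₂)·(max r₁ r₂)ⁿ` (mass identity `Σ_Z ∫ρ(Z,·) = ∫ρ_K`, `TermRep.sum_integral_piece` + `integral_Trho_eq`). [folklore] -/
theorem uniformWeightedJunction_of_junctionSupply (D : FiniteEpsData F G) (g₀ : ℕ → ℝ) (h : UniformJunctionSupply D g₀) :
    UniformWeightedJunction D g₀ := by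
  intro Cs
  obtain ⟨A₁, r₁, A₂, r₂, hA₁, hr₁, hr₁1, hA₂, hr₂, hr₂1, hkn⟩ := h Cs
  refine ⟨A₁ + A₂, max r₁ r₂, add_nonneg hA₁ hA₂, hr₁.trans (le_max_left _ _), max_lt_one hr₁1 hr₂1, fun k n => ?_⟩
  obtain ⟨ρr, A, near, hnear, hfar⟩ := hkn k n
  have hle : A₁ * r₁ ^ n + A₂ * r₂ ^ n ≤ (A₁ + A₂) * max r₁ r₂ ^ n := two_channel_le hA₁ hA₂ hr₁ hr₂ n
  have h0 : 0 ≤ (A₁ + A₂) * max r₁ r₂ ^ n :=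
    mul_nonneg (add_nonneg hA₁ hA₂) (pow_nonneg (hr₁.trans (le_max_left _ _)) n)
  classical
  refine ⟨ρr, A, fun _ => (A₁ + A₂) * max r₁ r₂ ^ n, fun Z => ?_, le_of_eq ?_⟩
  · by_cases hZ : near Z
    · rcases hnear Z hZ with ⟨L, h₁, h₂⟩ | ⟨L, h₁, h₂⟩
      · exact Or.inl ⟨L, (add_le_add h₁ h₂).trans hle⟩
      · exact Or.inr (Or.inl ⟨L, (add_le_add h₁ h₂).trans hle⟩)
    · exact Or.inr (Or.inr ⟨hfar Z hZ, h0⟩)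
  · rw [← Finset.mul_sum, ρr.sum_integral_piece,
      integral_Trho_eq D (k + 1 + n) (g₀ (k + 1 + n)) (lt_add_one_add k n)]

end Weighted

/-! ## §5 End to end: existence from the junction supply + an injected rate + the ladder good/bad datum; the targets under the
cell's explicit prefix -/

section EndToEnd

open Missing T4CauchySum

variable {F : T4Family} {G : Type*} [GaugeGroup G] [MeasurableSpace G] [HaarData G]
variable [∀ K j : ℕ, DecidableEq (PBond (F.P K) j)]

/-- **EXISTENCE FROM THE JUNCTION SUPPLY, A RUN LADDER AND THE GOOD/BAD DATUM ALONG IT** (the parent module's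
`hasContinuumLimit_of_supGap_ladder`; (W2) untouched). [folklore] -/
theorem hasContinuumLimit_of_junction_ladder [RegularGaugeGroup G] (D : FiniteEpsData F G) (hM : D.AvgMeasurable)
    (R : RunLadder D) (g₀ : ℕ → ℝ) (hW : UniformJunctionSupply D g₀) {C θ E ρ Λ : ℝ} {c : ℕ} {inj : ℕ → ℕ → ℝ}
    (hinj : InjectedRate C c θ inj) (hE : 0 ≤ E) (hθ : 0 ≤ θ) (hθ1 : θ < 1) (hρ : 0 ≤ ρ) (hρ1 : ρ < 1) (hΛ : 1 ≤ Λ)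
    (h : LadderGoodBadRate D R g₀ Λ E ρ inj) : HasContinuumLimit (D.scheme g₀) :=
  hasContinuumLimit_of_supGap_ladder D hM R g₀ (uniformSupGap_of_junctionSupply D hM g₀ hW) hinj hE hθ hθ1 hρ hρ1 hΛ h

/-- The near/far form of the same. [folklore] -/
theorem hasContinuumLimit_of_nearFar_ladder [RegularGaugeGroup G] (D : FiniteEpsData F G) (hM : D.AvgMeasurable)
    (R : RunLadder D) (g₀ : ℕ → ℝ) (hW : UniformNearFarGap D g₀) {C θ E ρ Λ : ℝ} {c : ℕ} {inj : ℕ → ℕ → ℝ}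
    (hinj : InjectedRate C c θ inj) (hE : 0 ≤ E) (hθ : 0 ≤ θ) (hθ1 : θ < 1) (hρ : 0 ≤ ρ) (hρ1 : ρ < 1) (hΛ : 1 ≤ Λ)
    (h : LadderGoodBadRate D R g₀ Λ E ρ inj) : HasContinuumLimit (D.scheme g₀) :=
  hasContinuumLimit_of_supGap_ladder D hM R g₀ (uniformSupGap_of_nearFar D g₀ hW) hinj hE hθ hθ1 hρ hρ1 hΛ h

/-- EXISTENCE from the MASS-WEIGHTED junction supply (through the parent module's `hasContinuumLimit_of_termwise_ladder`).
[folklore] -/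
theorem hasContinuumLimit_of_weightedJunction_ladder [RegularGaugeGroup G] (D : FiniteEpsData F G)
    (hM : D.AvgMeasurable) (R : RunLadder D) (g₀ : ℕ → ℝ) (hW : UniformWeightedJunction D g₀) {C θ E ρ Λ : ℝ} {c : ℕ}
    {inj : ℕ → ℕ → ℝ} (hinj : InjectedRate C c θ inj) (hE : 0 ≤ E) (hθ : 0 ≤ θ) (hθ1 : θ < 1) (hρ : 0 ≤ ρ) (hρ1 : ρ < 1)
    (hΛ : 1 ≤ Λ) (h : LadderGoodBadRate D R g₀ Λ E ρ inj) : HasContinuumLimit (D.scheme g₀) :=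
  hasContinuumLimit_of_termwise_ladder D hM R g₀ (uniformTermwiseGap_of_weightedJunction D hM g₀ hW) hinj hE hθ hθ1 hρ
    hρ1 hΛ h

/-- THE SUPPLIER-LEVEL DATA WITH (W1) AS A MASS-WEIGHTED JUNCTION SUPPLY, bundled. [folklore] -/
def WeightedJunctionRateTelescopeData (D : FiniteEpsData F G) (g₀ : ℕ → ℝ) : Prop :=
  UniformWeightedJunction D g₀ ∧ ∃ (C θ E ρ Λ : ℝ) (c : ℕ) (inj : ℕ → ℕ → ℝ), InjectedRate C c θ inj ∧ 0 ≤ E ∧ 0 ≤ θ ∧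
    θ < 1 ∧ 0 ≤ ρ ∧ ρ < 1 ∧ 1 ≤ Λ ∧ MidDiscrepancyRate D g₀ Λ E ρ inj

/-- `WeightedJunctionRateTelescopeData ⇒ TermwiseRateTelescopeData`. [folklore] -/
theorem termwiseRateTelescopeData_of_weightedJunction [RegularGaugeGroup G] (D : FiniteEpsData F G)
    (hM : D.AvgMeasurable) (g₀ : ℕ → ℝ) (h : WeightedJunctionRateTelescopeData D g₀) : TermwiseRateTelescopeData D g₀ :=
  ⟨uniformTermwiseGap_of_weightedJunction D hM g₀ h.1, h.2⟩

/-- **TARGET `ym4_torus_continuum_limit_exists` ⇐ the MASS-WEIGHTED junction supply + a mid-level discrepancy rate, under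
the cell's prefix.** [folklore] -/
theorem ym4_torus_continuum_limit_exists_of_weightedJunction [RegularGaugeGroup G] (D : FiniteEpsData F G)
    (hM : D.AvgMeasurable)
    (h : D.UnderHypotheses (BetaPertHyp D.βfun) fun g₀ => WeightedJunctionRateTelescopeData D g₀) :
    D.ym4_torus_continuum_limit_exists :=
  ym4_torus_continuum_limit_exists_of_termwise D hM
    (FiniteEpsData.UnderHypotheses.mono (fun g₀ hg => termwiseRateTelescopeData_of_weightedJunction D hM g₀ hg) h)

/-- THE SUPPLIER-LEVEL DATA OF THE FREE-LEVEL ROUTE WITH (W1) AS A JUNCTION SUPPLY, bundled: `UniformJunctionSupply` and a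
mid-level discrepancy rate under an injected rate (the parent module's `TermwiseRateTelescopeData` with its first conjunct
replaced). [folklore] -/
def JunctionRateTelescopeData (D : FiniteEpsData F G) (g₀ : ℕ → ℝ) : Prop :=
  UniformJunctionSupply D g₀ ∧ ∃ (C θ E ρ Λ : ℝ) (c : ℕ) (inj : ℕ → ℕ → ℝ), InjectedRate C c θ inj ∧ 0 ≤ E ∧ 0 ≤ θ ∧
    θ < 1 ∧ 0 ≤ ρ ∧ ρ < 1 ∧ 1 ≤ Λ ∧ MidDiscrepancyRate D g₀ Λ E ρ inj

/-- `JunctionRateTelescopeData ⇒ TermwiseRateTelescopeData` (§4 + the parent module's mass identity). [folklore] -/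
theorem termwiseRateTelescopeData_of_junction [RegularGaugeGroup G] (D : FiniteEpsData F G) (hM : D.AvgMeasurable)
    (g₀ : ℕ → ℝ) (h : JunctionRateTelescopeData D g₀) : TermwiseRateTelescopeData D g₀ :=
  ⟨uniformTermwiseGap_of_supGap D g₀ (uniformSupGap_of_junctionSupply D hM g₀ h.1), h.2⟩

/-- **TARGET `ym4_torus_continuum_limit_exists` ⇐ the junction supply + a mid-level discrepancy rate, under the cell's prefix**
(β-hypothesis `BetaPertHyp` and (B) explicit in `UnderHypotheses`; nothing hidden). [folklore] -/
theorem ym4_torus_continuum_limit_exists_of_junction [RegularGaugeGroup G] (D : FiniteEpsData F G)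
    (hM : D.AvgMeasurable) (h : D.UnderHypotheses (BetaPertHyp D.βfun) fun g₀ => JunctionRateTelescopeData D g₀) :
    D.ym4_torus_continuum_limit_exists :=
  ym4_torus_continuum_limit_exists_of_termwise D hM
    (FiniteEpsData.UnderHypotheses.mono (fun g₀ hg => termwiseRateTelescopeData_of_junction D hM g₀ hg) h)

/-- … and the uniqueness target. [cite: MagnenRivasseauSeneor1993, p.326] -/
theorem ym4_torus_continuum_limit_unique_of_junction [RegularGaugeGroup G] (D : FiniteEpsData F G)
    (hM : D.AvgMeasurable) (h : D.UnderHypotheses (BetaPertHyp D.βfun) fun g₀ => JunctionRateTelescopeData D g₀) :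
    D.ym4_torus_continuum_limit_unique :=
  D.limit_unique_of_limit_exists (ym4_torus_continuum_limit_exists_of_junction D hM h)

/-- PRINT-FAITHFUL FORM of the existence target from the junction supplier-level data. [cite: Balaban1987RG1, Thm 2 p.259] -/
theorem ym4_torus_continuum_limit_exists'_of_junction [RegularGaugeGroup G] (D : FiniteEpsData F G)
    (hM : D.AvgMeasurable)
    (h : D.UnderHypotheses (DagBinding.EndpointExistence D.C.toB12) fun g₀ => JunctionRateTelescopeData D g₀) :
    D.ym4_torus_continuum_limit_exists' :=
  ym4_torus_continuum_limit_exists'_of_termwise D hM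
    (FiniteEpsData.UnderHypotheses.mono (fun g₀ hg => termwiseRateTelescopeData_of_junction D hM g₀ hg) h)

end EndToEnd

end Literature.MathematicalPhysics.QuantumFieldTheory.Balaban1983to89.T4UniformDefectJunction
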